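import Literature.MathematicalPhysics.QuantumFieldTheory.Balaban1983to89.Node00.TorusCoverPropSixGaugeLevels
import Literature.MathematicalPhysics.QuantumFieldTheory.Balaban1983to89.Node00.TorusCoverSUGaugeLocalPhase
import Literature.MathematicalPhysics.QuantumFieldTheory.Balaban1983to89.Node00.CarriersB8CubeDentedRec

/-!
# NODE 00 — THE R7 DOOR, STAGE 1 (on `ℤᵈ`): [Balaban1985RegularSpaces] Prop. 6's gauge READ AS AN `SU(N)` GAUGE ON THE WHOLE DENTED RECORD TOWER `Ω′₀ = □₀`, WITH
# [Balaban1985Variational] (152)'s LEVEL-WEIGHTED LETTERS, THE RECORD's (153) AND (1.29), AND THE MEMBER GAUGE EXPORTED — this lineage's g7∕g8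
# `exists_suGauge_letters152_tower(_member)` re-run from the `SU(N)`-valued ∃-body of the RECORD crown `Node00.GaugedBoundB8DZ` on a `Node00.CubeB8DZ` (the «N05-REC» R6∕R7 interface)

Cell `pub-ymgap`, width seat `pub-ymgap-dag-n07-w3` g10 (N05-REC R7 pen; LEAD PEN dag-n05-e).  NEW leaf, THEOREMS ONLY.  CONSUMED BY NAME, nothing modified: this seat's `Node00.CarriersB8CubeDentedRec`
(`CubeB8DZ`, its tower `sq`, cells `lamS`, `vfix ∕ fixed ∕ expo ∕ axial`, readings `sq_zero ∕ sq_of_lt`), `Node00.TorusCoverPropSixGaugeLevels` (the p. 86 supremum read at level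
`k − 1`), this lineage's g8 `Node00.TorusCoverSUGaugeLocalPhase.exists_suGauge_of_specialUnitaryGauge_local` (SU in ⇒ SU out), dag-n05-d's `B8Eq131CubesRec` (`cubeZ boxZ tcubeZ
bLoZ bHiZ`, `cube_eq`, `box_subset_cube`, `cube_anti`, `cube_subset_tcube`), `B8Eq119TwistedAxialRec.Restr129Z`, `B8Eq138LandauZdRec.IsLandau138(W)Z`, `B7SectEFLinearisationRec.logCovIterZ`,
dag-n05-e's `BlockAveragingZd.avgIterZ`.  `--kind proof --supports stmt-QuantumFields-20541` (K0⁷; count-neutral).  [6] = [Balaban1985RegularSpaces]; [15] = [Balaban1985Variational];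
[I] = [Balaban1987RG1].

THE DENT ([15] (148)–(150), dag-n07-e's LOCATED-DENT-WEIGHTS).  On the record tower `Ω′_j = □_j` (`j < k`), `Ω′_k = □_k ∩ Ω_k`: the crown's letters carry the weight of the member
they touch, so on the PURE top cube `□_k` (which contains print's box `□` but may stick out of `Ω_k`) every bond touches `Ω′_{k−1} = □_{k−1} ⊇ □_k` (`k ≥ 1`) and the four
top letters are read at level `k − 1`: `‖A‖ ≤ 2r(L^{k−1}η)⁻¹`, `|∇A| ≤ 2ηr((L^{k−1}η)²)⁻¹`, `|∂*∂A|, |ΔA| ≤ 2r((L^{k−1}η)³)⁻¹` — a factor `L`, `L²`, `L³` off the pure-cube readings,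
absorbed downstream by the record's constant `B₁` (`HThm4RecEx`: `∃ B₁`).

WHAT IS PROVED (kernel; `𝔸 = M_N(ℂ)`, `N ≥ 1`, `d ≥ 2`, odd `L ≥ 3`; no definition).
* `sideTouches_of_mem_fam` (a bond with both… with its base point in `S` side-touches `S`, `d ≥ 2`), `CubeB8DZ.mem_sq_zero_iff_inBox` (`Ω′₀ = □₀` as a centred `InBox`),
  `CubeB8DZ.cube_top_subset_sq_pred` (`□_k ⊆ Ω′_{k−1}`), `CubeB8DZ.sq_zero_subset_tcube` (`□₀ ⊆ □̃`).
* ★★★ `exists_suGauge_letters152_recTower_member`: from the `SU(N)`-valued ∃-body of `GaugedBoundB8DZ L η V c r` (conjuncts 1, 6 at `specialUnitaryUnits`; `η > 0`, `r ≥ 0`, per-bond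
  window `4·(N r) < 2π`): ONE `s : ℤᵈ → SU(N)` and the member witness `u_m` with — (i) `V^{ιSU∘s}(b) = cfgExp η A′ b` on every bond of `Ω′₀ = □₀`, `A′ := logCfg η (U″^{u_m⁻¹})`;
  (ii) `∀ j ≤ k`, `‖A′(b)‖ ≤ 2·(r·(Lʲη)⁻¹)` on bonds with both end-points in `Ω′_j`; (iii) on the pure top cube `□_k`: `‖A′‖ ≤ 2r(L^{k−1}η)⁻¹`, gradients `≤ 2ηr((L^{k−1}η)²)⁻¹`,
  `∂*∂` and `Δ` `≤ 2r((L^{k−1}η)³)⁻¹`; (iv) `IsLandau138Z L k η □₀ Λ′ 1 A′` (the RECORD's (153)); (v) ★ `ιSU (s x) = (u_m x)⁻¹·v_fix x` on `□₀`; (vi) `u_m ∈ SU(N)`, `u_m = 1` off `□₀`,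
  ★ `Restr129Z L k Λ′ 1 u_m` (the RECORD's (1.29)), the RECORD's (1.137).
HONEST FRAMING: count-neutral bookkeeping (SU normalisation + the p. 86 supremum read pointwise) over a HYPOTHESIS — the record crown body, which the R6 re-key of the «N05-REC»
road is to conclude; nothing of [6] ∕ [15] ∕ [I] analysis asserted; `HThm4Rec` UNDISCHARGED (caveat (C-S3-1)); N07 ∕ N05 NOT discharged; counts unmoved; one finite 𝕋⁴ programme at
fixed ε — R4 closes the conditional finite-𝕋⁴ rung `BalabanLadder.UV` only; the YM mass gap (Clay) is NOT proved by any of this; nothing continuum ∕ ℝ⁴ ∕ OS.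
No `sorry`, no `def`, no `instance`, no `notation`.

References: [6] Prop. 6 (1.135)–(1.138) p.99, (1.29) p.81, (1.131) p.99, p.98, p.86, p.76; [15] (144)–(153) pp.300–301; [3] = [Balaban1985Averaging] (78)–(81) p.30; [I] (0.3)–(0.4) pp.252–253.
-/

noncomputable section

namespace Literature.MathematicalPhysics.QuantumFieldTheory.Balaban1983to89.Node00

open scoped Matrix.Norms.L2Operator
open B7Prop1Explicit (e e_apply gaugeAct)
open B7Prop1Local (InBox AgreeOn)
open B7Prop2Explicit (unitaryUnits mem_unitaryUnits)
open B7Prop2SpecialUnitary (specialUnitaryUnits mem_specialUnitaryUnits)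
open BlockAveragingZd (avgIterZ ctrShift)
open B8Ineq132 (covDerivFwd covDeriv BondTouches)
open B8Eq131Cubes (tLo tHi ctr gs)
open B8Eq131CubesRec (boxZ cubeZ tcubeZ bLoZ bHiZ)
open B8Eq140Level (SideTouches sideTouches_of_bondTouches)
open B8Eq138LandauZd (logCfg covDivB covLap)
open B8Eq138LandauZdRec (IsLandau138Z IsLandau138WZ)
open B8Eq119TwistedAxialRec (Restr129Z)
open B7SectEFLinearisationRec (logCovIterZ)
open B8Eq184Proof (cfgExp)
open B8LeafModelZd3 (mlogCfg)
open B8ScaledSupNorm (msup Bdd bondNorm)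
open B8Eq146AExpansion (plaqCovDeriv iEta)
open B8Eq143PlaqExpansion (pdiv)
open MatrixLog (mlog)

variable {d N : ℕ} [NeZero N]

section RecTower

variable {L K : ℕ} {Ω : ℕ → Set (B7Prop1Explicit.Site d)}

omit [NeZero N] in
/-- In `d ≥ 2` dimensions a bond based at a site of `S` is a side of a plaquette touching `S` (the p. 77 side convention needs a second direction).
[cite: Balaban1985RegularSpaces, p.77 (convention before (1.5))] -/
theorem sideTouches_of_mem_fam (hd : 2 ≤ d) {S : Set (B7Prop1Explicit.Site d)} {x : B7Prop1Explicit.Site d} (hx : x ∈ S) (μ : Fin d) : SideTouches S x μ := by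
  obtain ⟨κ, hκ⟩ : ∃ κ : Fin d, κ ≠ μ := by
    by_cases h0 : μ.val = 0
    · exact ⟨⟨1, by omega⟩, fun h => by have := congrArg Fin.val h; simp at this; omega⟩
    · exact ⟨⟨0, by omega⟩, fun h => by have := congrArg Fin.val h; simp at this; omega⟩
  exact sideTouches_of_bondTouches hκ (Or.inl hx)

omit [NeZero N] in
/-- **`Ω′₀ = □₀` AS A CENTRED BOX OF `ℤᵈ`** (odd `L`): `x ∈ c.sq 0 ↔ InBox (bLoZ L a k (ρ·gs L k)) (bHiZ L a M k (ρ·gs L k)) x`. [cite: Balaban1985RegularSpaces, (1.131) p.99, p.98; Balaban1987RG1, (0.3) p.252] -/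
theorem CubeB8DZ.mem_sq_zero_iff_inBox (hLo : Odd L) (c : CubeB8DZ d L K Ω) (x : B7Prop1Explicit.Site d) :
    x ∈ c.sq 0 ↔ InBox (bLoZ L c.a c.k (c.ρ * gs L c.k)) (bHiZ L c.a c.M c.k (c.ρ * gs L c.k)) x := by
  rw [c.sq_zero, B8Eq131CubesRec.cube_eq hLo (Nat.zero_le _)]
  simp only [pow_zero, one_mul, Nat.sub_zero, Set.mem_setOf_eq]

omit [NeZero N] in
/-- **`□_k ⊆ Ω′_{k−1}`** — the pure top cube, dent and all, lies in the next member down (`k ≥ 1`, odd `L`). [cite: Balaban1985Variational, (148)–(150) p.301; Balaban1985RegularSpaces, p.98] -/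
theorem CubeB8DZ.cube_top_subset_sq_pred (hLo : Odd L) (c : CubeB8DZ d L K Ω) : cubeZ L c.a c.M c.ρ c.k c.k ⊆ c.sq (c.k - 1) := by
  rw [c.sq_of_lt (by have := c.one_le_k; omega)]
  exact B8Eq131CubesRec.cube_anti hLo (Nat.sub_le _ _) le_rfl

omit [NeZero N] in
/-- `Ω′₀ = □₀ ⊆ □̃` (odd `L ≥ 2`). [cite: Balaban1985RegularSpaces, p.98 («We cover □₀ by a smallest family of cubes … □̃»); Balaban1987RG1, (0.3) p.252] -/
theorem CubeB8DZ.sq_zero_subset_tcube (hLo : Odd L) (hL : 2 ≤ L) (c : CubeB8DZ d L K Ω) : c.sq 0 ⊆ tcubeZ L c.a c.M c.ρ c.k := by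
  rw [c.sq_zero]
  exact B8Eq131CubesRec.cube_subset_tcube hLo hL (le_trans (le_trans one_le_two hL) c.L_le_ρ) (Nat.zero_le _)

/-- ★★★ **[6] PROPOSITION 6's GAUGE ON THE WHOLE DENTED RECORD TOWER `□₀`, WITH THE MEMBER GAUGE EXPORTED** — this lineage's g8 `exists_suGauge_letters152_tower_member` re-run from
the `SU(N)`-valued ∃-body of the RECORD crown `GaugedBoundB8DZ L η V c r` (conjuncts 1 and 6 at `specialUnitaryUnits`; `η > 0`, `r ≥ 0`, per-bond window `4·(N r) < 2π`; odd `L ≥ 2`,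
`d ≥ 2`): ONE `s : ℤᵈ → SU(N)`, the exponent `A′ := logCfg η (U″^{u_m⁻¹})` and the member witness `u_m` with — (i) `V^{ιSU∘s}(b) = cfgExp η A′ b` on every bond of `Ω′₀ = □₀`; (ii)
`∀ j ≤ k`, `‖A′(b)‖ ≤ 2·(r·(Lʲη)⁻¹)` on bonds with both ends in `Ω′_j`; (iii) on the pure top cube `□_k` (⊇ print's `□`, dent included) the four letters AT LEVEL `k − 1`; (iv) the
RECORD's (153) `IsLandau138Z L k η □₀ Λ′ 1 A′`; (v) ★ `ιSU (s x) = (u_m x)⁻¹·v_fix x` on `□₀`; (vi) `u_m x ∈ SU(N)`, `u_m = 1` off `□₀`, ★ the RECORD's (1.29) `Restr129Z L k Λ′ 1 u_m`,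
the RECORD's (1.137). [cite: Balaban1985RegularSpaces, Prop. 6 (1.135)–(1.138) p.99, (1.29) p.81, (1.131) p.99, p.76; Balaban1985Variational, (144)–(153) pp.300–301; Balaban1985Averaging, (78)–(81) p.30; Balaban1987RG1, (0.3)–(0.4) pp.252–253] -/
theorem exists_suGauge_letters152_recTower_member (hd : 2 ≤ d) (hLo : Odd L) (hL : 2 ≤ L) (c : CubeB8DZ d L K Ω)
    (V : B7Prop1Explicit.Site d → Fin d → (MatA N)ˣ) (hV : ∀ x μ, V x μ ∈ specialUnitaryUnits (Fin N)) {η r : ℝ} (hη : 0 < η) (hr : 0 ≤ r)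
    (hG : letI : CStarAlgebra (MatA N) := {};
      ∃ u : B7Prop1Explicit.Site d → (MatA N)ˣ, (∀ x, u x ∈ specialUnitaryUnits (Fin N)) ∧ (∀ x, x ∉ c.sq 0 → u x = 1) ∧
        Restr129Z L c.k c.lamS (1 : B7Prop1Explicit.Site d → Fin d → (MatA N)ˣ) u ∧
        IsLandau138WZ L c.k η (c.sq 0) c.lamS (1 : B7Prop1Explicit.Site d → Fin d → (MatA N)ˣ) (c.fixed V u) ∧
        (∀ j, j ≤ c.k → ∀ b ∈ {b : B7Prop1Explicit.Site d × Fin d | SideTouches (c.sq j) b.1 b.2},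
          c.fixed V u b.1 b.2 = cfgExp η (logCfg η (c.fixed V u)) b.1 b.2 ∧ IsSelfAdjoint (logCfg η (c.fixed V u) b.1 b.2) ∧
            ‖logCfg η (c.fixed V u) b.1 b.2‖ ≤ r * ((L : ℝ) ^ j * η)⁻¹) ∧
        (∀ x, ((c.vfix V)⁻¹ * u) x ∈ specialUnitaryUnits (Fin N)) ∧
        AgreeOn (B8Ineq130Rec.tlo L (tLo c.a c.ρ) c.k) (B8Ineq130Rec.thi L (tHi c.a c.M c.ρ) c.k) (gaugeAct ((c.vfix V)⁻¹ * u)⁻¹ V) (c.fixed V u) ∧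
        msup L c.k η (-(2 : ℝ)) (fun j (t : Fin d × Fin d × B7Prop1Explicit.Site d) => SideTouches (c.sq j) t.2.2 t.2.1)
            (fun t => covDerivFwd η (1 : B7Prop1Explicit.Site d → Fin d → (MatA N)ˣ) t.1 (fun z => c.expo η V u z t.2.1) t.2.2) ≤ r ∧
        bondNorm L c.k η (-(3 : ℝ)) c.sq
            (fun x μ => pdiv η (1 : B7Prop1Explicit.Site d → Fin d → (MatA N)ˣ) (plaqCovDeriv η (1 : B7Prop1Explicit.Site d → Fin d → (MatA N)ˣ) (c.expo η V u)) μ x) ≤ r ∧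
        bondNorm L c.k η (-(3 : ℝ)) c.sq (fun x μ => covLap η (1 : B7Prop1Explicit.Site d → Fin d → (MatA N)ˣ) (fun z => c.expo η V u z μ) x) ≤ r ∧
        (∀ (x : B7Prop1Explicit.Site d) (μ : Fin d), bLoZ L c.a 0 0 ≤ x → x + e μ ≤ bHiZ L c.a c.M 0 0 → c.inTop x → c.inTop (x + e μ) →
          logCovIterZ L (1 : B7Prop1Explicit.Site d → Fin d → (MatA N)ˣ) (iEta η (c.expo η V u)) c.k x μ =
            mlog ((avgIterZ L (c.axial V) c.k x μ : (MatA N)ˣ) : MatA N)))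
    (hsmall : 4 * ((N : ℝ) * r) < 2 * Real.pi) :
    letI : CStarAlgebra (MatA N) := {}
    ∃ s : B7Prop1Explicit.Site d → Matrix.specialUnitaryGroup (Fin N) ℂ, ∃ um : B7Prop1Explicit.Site d → (MatA N)ˣ,
      (∀ x μ, x ∈ c.sq 0 → x + e μ ∈ c.sq 0 →
          gaugeAct (fun y => ιSU N (s y)) V x μ = cfgExp η (logCfg η (c.fixed V um)) x μ) ∧
      (∀ j, j ≤ c.k → ∀ x μ, x ∈ c.sq j → x + e μ ∈ c.sq j → ‖logCfg η (c.fixed V um) x μ‖ ≤ 2 * (r * ((L : ℝ) ^ j * η)⁻¹)) ∧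
      (∀ x μ, x ∈ cubeZ L c.a c.M c.ρ c.k c.k → x + e μ ∈ cubeZ L c.a c.M c.ρ c.k c.k →
          ‖logCfg η (c.fixed V um) x μ‖ ≤ 2 * (r * ((L : ℝ) ^ (c.k - 1) * η)⁻¹)) ∧
      (∀ x μ ν, x ∈ cubeZ L c.a c.M c.ρ c.k c.k → x + e μ ∈ cubeZ L c.a c.M c.ρ c.k c.k → x + e ν ∈ cubeZ L c.a c.M c.ρ c.k c.k →
          ‖logCfg η (c.fixed V um) (x + e μ) ν - logCfg η (c.fixed V um) x ν‖ ≤ 2 * (η * r * (((L : ℝ) ^ (c.k - 1) * η) ^ 2)⁻¹)) ∧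
      (∀ x μ, x ∈ cubeZ L c.a c.M c.ρ c.k c.k → x + e μ ∈ cubeZ L c.a c.M c.ρ c.k c.k →
          (∀ ν, x + e ν ∈ cubeZ L c.a c.M c.ρ c.k c.k ∧ x - e ν ∈ cubeZ L c.a c.M c.ρ c.k c.k ∧ x - e ν + e μ ∈ cubeZ L c.a c.M c.ρ c.k c.k) →
          ‖pdiv η (1 : B7Prop1Explicit.Site d → Fin d → (MatA N)ˣ) (plaqCovDeriv η 1 (logCfg η (c.fixed V um))) μ x‖ ≤
            2 * (r * (((L : ℝ) ^ (c.k - 1) * η) ^ 3)⁻¹)) ∧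
      (∀ x μ, x ∈ cubeZ L c.a c.M c.ρ c.k c.k → x + e μ ∈ cubeZ L c.a c.M c.ρ c.k c.k →
          (∀ ν, x + e ν ∈ cubeZ L c.a c.M c.ρ c.k c.k ∧ x - e ν ∈ cubeZ L c.a c.M c.ρ c.k c.k) →
          ‖covLap η (1 : B7Prop1Explicit.Site d → Fin d → (MatA N)ˣ) (fun z => logCfg η (c.fixed V um) z μ) x‖ ≤ 2 * (r * (((L : ℝ) ^ (c.k - 1) * η) ^ 3)⁻¹)) ∧
      IsLandau138Z L c.k η (c.sq 0) c.lamS (1 : B7Prop1Explicit.Site d → Fin d → (MatA N)ˣ) (logCfg η (c.fixed V um)) ∧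
      (∀ x, x ∈ c.sq 0 → ιSU N (s x) = (um x)⁻¹ * c.vfix V x) ∧
      (∀ x, um x ∈ specialUnitaryUnits (Fin N)) ∧ (∀ x, x ∉ c.sq 0 → um x = 1) ∧
      Restr129Z L c.k c.lamS (1 : B7Prop1Explicit.Site d → Fin d → (MatA N)ˣ) um ∧
      (∀ (x : B7Prop1Explicit.Site d) (μ : Fin d), bLoZ L c.a 0 0 ≤ x → x + e μ ≤ bHiZ L c.a c.M 0 0 → c.inTop x → c.inTop (x + e μ) →
        logCovIterZ L (1 : B7Prop1Explicit.Site d → Fin d → (MatA N)ˣ) (iEta η (c.expo η V um)) c.k x μ =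
          mlog ((avgIterZ L (c.axial V) c.k x μ : (MatA N)ˣ) : MatA N)) := by
  letI : CStarAlgebra (MatA N) := {}
  have hL1 : 1 ≤ L := le_trans (by norm_num) hL
  have hk1 : c.k - 1 ≤ c.k := Nat.sub_le _ _
  obtain ⟨u, hu, hoff, h129, h138, h162, hw, h135, h136₂, h136₃, h136₄, h137⟩ := hG
  set w : B7Prop1Explicit.Site d → (MatA N)ˣ := (c.vfix V)⁻¹ * u with hwdef
  set U₁ : B7Prop1Explicit.Site d → Fin d → (MatA N)ˣ := c.fixed V u with hU₁
  have h138' : IsLandau138Z L c.k η (c.sq 0) c.lamS (1 : B7Prop1Explicit.Site d → Fin d → (MatA N)ˣ) (logCfg η U₁) := h138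
  have h136' : ∀ j, j ≤ c.k → ∀ b ∈ {b : B7Prop1Explicit.Site d × Fin d | SideTouches (c.sq j) b.1 b.2},
      ‖logCfg η U₁ b.1 b.2‖ ≤ r * ((L : ℝ) ^ j * η)⁻¹ := fun j hj b hb => (h162 j hj b hb).2.2
  -- `□₀` as a centred `InBox`, inside `□̃`
  set lo₀ : B7Prop1Explicit.Site d := bLoZ L c.a c.k (c.ρ * gs L c.k) with hlo₀
  set hi₀ : B7Prop1Explicit.Site d := bHiZ L c.a c.M c.k (c.ρ * gs L c.k) with hhi₀
  have hsq : ∀ x, InBox lo₀ hi₀ x ↔ x ∈ c.sq 0 := fun x => (CubeB8DZ.mem_sq_zero_iff_inBox hLo c x).symm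
  have hsqT : c.sq 0 ⊆ tcubeZ L c.a c.M c.ρ c.k := CubeB8DZ.sq_zero_subset_tcube hLo hL c
  -- the data of the SU normalisation on the box `□₀`: `w⁻¹` is `SU(N)`-valued
  have hg : ∀ x, InBox lo₀ hi₀ x → w⁻¹ x ∈ specialUnitaryUnits (Fin N) := fun x _ => by
    rw [Pi.inv_apply]; exact (specialUnitaryUnits (Fin N)).inv_mem (hw x)
  have hgauge : ∀ x μ, InBox lo₀ hi₀ x → InBox lo₀ hi₀ (x + e μ) → gaugeAct w⁻¹ V x μ = cfgExp η (logCfg η U₁) x μ := by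
    intro x μ hx hx'
    have hx0 := (hsq x).1 hx
    rw [h135 x μ (hsqT hx0) (hsqT ((hsq _).1 hx'))]
    exact (h162 0 (Nat.zero_le _) (x, μ) (sideTouches_of_mem_fam hd hx0 μ)).1
  have hsa : ∀ x μ, InBox lo₀ hi₀ x → InBox lo₀ hi₀ (x + e μ) → IsSelfAdjoint (logCfg η U₁ x μ) := fun x μ hx _ =>
    (h162 0 (Nat.zero_le _) (x, μ) (sideTouches_of_mem_fam hd ((hsq x).1 hx) μ)).2.1
  have hA : ∀ x μ, InBox lo₀ hi₀ x → InBox lo₀ hi₀ (x + e μ) → η * (N * ‖logCfg η U₁ x μ‖) ≤ N * r := by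
    intro x μ hx _
    have h := h136' 0 (Nat.zero_le _) (x, μ) (sideTouches_of_mem_fam hd ((hsq x).1 hx) μ)
    simp only [pow_zero, one_mul] at h
    have hN : (0 : ℝ) ≤ N := Nat.cast_nonneg N
    calc η * (N * ‖logCfg η U₁ x μ‖) ≤ η * (N * (r * η⁻¹)) := mul_le_mul_of_nonneg_left (mul_le_mul_of_nonneg_left h hN) hη.le
      _ = N * r := by field_simp
  have hVdet : ∀ x μ, InBox lo₀ hi₀ x → InBox lo₀ hi₀ (x + e μ) → ((V x μ : (MatA N)ˣ) : MatA N).det = 1 := fun x μ _ _ =>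
    (Matrix.mem_specialUnitaryGroup_iff.1 (hV x μ)).2
  obtain ⟨s, hs, -, hsg⟩ := exists_suGauge_of_specialUnitaryGauge_local lo₀ hi₀ hη V w⁻¹ (logCfg η U₁) hVdet hg hgauge hsa hA hsmall
  -- the pure top cube `□_k` lies in `Ω′_{k−1}`: every bond based in it is a side touching the tower (the window of the unmasked readings)
  have htop : cubeZ L c.a c.M c.ρ c.k c.k ⊆ c.sq (c.k - 1) := CubeB8DZ.cube_top_subset_sq_pred hLo c
  have hW : ∀ y ∈ cubeZ L c.a c.M c.ρ c.k c.k, ∀ τ : Fin d, ∃ j, j ≤ c.k ∧ SideTouches (c.sq j) y τ :=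
    fun y hy τ => ⟨c.k - 1, hk1, sideTouches_of_mem_fam hd (htop hy) τ⟩
  -- weakening `t ≤ 2t` for the nonnegative letters
  have h2 : ∀ {a t : ℝ}, 0 ≤ t → a ≤ t → a ≤ 2 * t := fun ht h => h.trans (by linarith)
  have hLη : ∀ j : ℕ, 0 ≤ r * ((L : ℝ) ^ j * η)⁻¹ := fun j => by positivity
  refine ⟨s, u, fun x μ hx hx' => hsg x μ ((hsq x).2 hx) ((hsq _).2 hx'), fun j hj x μ hx _ => ?_, fun x μ hx _ => ?_, fun x μ ν hx hx' _ => ?_,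
    fun x μ hx hx' hν => ?_, fun x μ hx _ hν => ?_, h138', fun x hx => ?_, hu, hoff, h129, h137⟩
  · exact h2 (hLη j) (h136' j hj (x, μ) (sideTouches_of_mem_fam hd hx μ))
  · exact h2 (hLη (c.k - 1)) (h136' (c.k - 1) hk1 (x, μ) (sideTouches_of_mem_fam hd (htop hx) μ))
  · exact h2 (by positivity) (norm_logCfg_sub_le_of_msup_grad_at c.sq c.k hL1 hη hr U₁ h136' h136₂ hW hk1 hx hx'
      (sideTouches_of_mem_fam hd (htop hx) ν))
  · exact h2 (by positivity) (norm_codiff_logCfg_le_at c.sq c.k hL1 hη hr U₁ h136' h136₃ hW hk1 hx hx' hν (Or.inl (htop hx)))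
  · exact h2 (by positivity) (norm_lap_logCfg_le_at c.sq c.k hL1 hη hr U₁ h136' h136₄ hW hk1 hx (fun ν => ⟨(hν ν).1, (hν ν).2⟩) (Or.inl (htop hx)))
  · rw [hs x ((hsq x).2 hx), hwdef]
    simp only [Pi.inv_apply, Pi.mul_apply, mul_inv_rev, inv_inv]

end RecTower

end Literature.MathematicalPhysics.QuantumFieldTheory.Balaban1983to89.Node00

end

/-! ## Axiom audit (gate whitelist: `propext`, `Classical.choice`, `Quot.sound`) -/
#print axioms Literature.MathematicalPhysics.QuantumFieldTheory.Balaban1983to89.Node00.exists_suGauge_letters152_recTower_member
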